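import Literature.NumberTheory.ComplexMultiplication.CosetGermEndomorphismKernel
import Literature.NumberTheory.ComplexMultiplication.AlmostCartesianSquares
import HarnessLib

/-!
# Milne 1999 §6 pp. 69–71, LEMMAS 6.7–6.9 in the group ring: `X^*(S^K) ⊂ ℤ[Γ]`, `X^*(α) = (Σ f(τ)τ ↦ Σ f(τ)τD)`, the maps of the square
# `X^*(T^Ψ) ⊕ X^*(T^Ψ̄) → X^*(S^K)` over `X^*(L^Π) ⊕ X^*(L^Π̄) → X^*(P^K)`, injectivity of the bottom maps (6.7, 6.8) and LEMMA 6.9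
# «the square is almost Cartesian» (J. S. Milne, *Lefschetz motives and the Tate conjecture*, Compositio Math. 117 (1999), §6 pp. 69–71)

Family `hodge`, lane `lit-hodgefound` (Layer A3; seat `lit-hodgefound-p27`, generation 17, row g17-#3); topic
`Literature/NumberTheory/ComplexMultiplication`, namespace `Literature.NumberTheory.ComplexMultiplication.CosetGerm`.  Direct sequel of g17-#2
`CosetGermEndomorphismKernel` (`Setting ι Γ₀ D`, `psi`, `halfCosets`, `frame`, `pushFun_psi`, `HasPrintedValues`, `ker_eq_rel`,
`injective_of_hasPrintedValues`) and of g16-#8 `AlmostCartesianSquares` (`IsAlmostCartesian`, LEMMA 6.3); generic carriers Q731/g15-#1/g16-#6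
(`OrbitTorus.aug/act/rel/CharModule/liftChar/pushFun/push`).  GROUP-RING ALGEBRA ONLY, for an abstract finite group `Γ = Γ₀ × ⟨ι⟩ ⊇ Γ₀ ⊇ D`
(hypothesis structure `Setting`) with coefficients in a commutative ring `R` without zero divisors, `2 ≠ 0`, `d = |D| ≠ 0` in `R` (Milne: `ℤ`):
Milne's six character groups and the maps between them are realised INSIDE `R[Γ]` and `R[Γ/D]` through Lemma 5.1's diagram (`X^*(S^K) ↪ ℤ[Γ]`,
`X^*(P^K) ↪ ℤ[Γ/D]` by `π ↦ f_π`, `X^*(α)` = «`Σ f(τ)τ ↦ Σ f(τ)(τD)`»), and LEMMA 6.9 is proved for them.  Definitions with bodies + THEOREMS;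
no named fact (D-0026, net debt 0).  The identification of these models with the seat's number-theoretic carriers (`K = Q·F`, `w₀`,
`D = D(w₀)`, `W^K(p^∞)`, `f_π`) is NOT made here.

THE PRINT.  [Milne1999] §6 p. 69 L18 – p. 71 L22 (held `paper:doi-10-1023-a-1000776613765` p0025–p0027), verbatim: «We have a commutative diagram
(Lemma 5.1): [`X^*(S^K) −(natural inclusion)→ ℤ[Γ]`, `X^*(P^K) −(π ↦ f_π)→ ℤ[Γ/D]`].  The first vertical map is `X^*(α^K)`, which maps `f` to
`π(f)`, and the second is `Σ f(τ)τ ↦ Σ f(τ)(τD)`.  Let `ψ_i = τ_i + Σ_{j≠i} ιτ_j`, `ψ̄ = Σ ιτ_i`.  Then `ψ₀, …, ψ_{n−1}, ψ̄` form a basis for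
`X^*(S^K)` (Lemma 3.3). As `τ_iψ₀ = ψ_i`, `(ιτ_i)ψ₀ = ιψ_i` we see that `Ψ = {ψ₀, …, ψ_{n−1}, ιψ₀, …, ιψ_{n−1}}` is a `Γ`-orbit in `X^*(S^K)`.
Let `π_i = π(ψ_{id}) ∈ W^K_{1,+}(p^∞)`. Then `Π = {π₀, …, π_{(n/d)−1}, ιπ₀, …, ιπ_{(n/d)−1}}` is a `Γ`-orbit in `X^*(P^K)`.  LEMMA 6.7. The diagram
[`X^*(T^Ψ) −X^*(γ)→ X^*(S^K)` over `X^*(L^Π) −X^*(β)→ X^*(P^K)`, verticals `X^*(α′)`, `X^*(α)`] becomes almost Cartesian when the two groups at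
right are replaced by the images of the horizontal arrows.  Proof. We shall prove this by showing that the bottom map is injective. The map
`τ ↦ τπ₀` defines a bijection `Γ/D → Π`, and hence an isomorphism `ℤ[Γ/D] → ℤ[Π]` … [g17-#2].  As `τ_iψ̄ = ψ̄` and `ιτ_iψ̄ = ιψ̄`, `Ψ̄ = {ψ̄, ιψ̄}`
is a `Γ`-orbit. Let `π̄ = π(ψ̄)`, and let `Π̄ = {π̄, ιπ̄}`.  LEMMA 6.8. The diagram [for `Ψ̄`, `Π̄`] becomes almost Cartesian when the two groups
at right are replaced by the images of the horizontal arrows.  Proof. As in the preceding lemma, one shows that the bottom arrow is injective.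
LEMMA 6.9. The square `X^*(T^Ψ) ⊕ X^*(T^Ψ̄) → X^*(S^K)` [over] `X^*(T^Π) ⊕ X^*(T^Π̄) → X^*(P^K)` is almost Cartesian.  Proof. Consider
`X^*(T^Ψ) ⊕ X^*(T^Ψ̄) → ℤ[Γ]ψ₀ ⊕ ℤ[Γ]ψ̄ → X^*(S^K)` [over] `X^*(T^Π) ⊕ X^*(T^Π̄) → ℤ[Γ/D]π₀ ⊕ ℤ[Γ/D]π̄ → X^*(P^K)`.  The left-hand square is
almost Cartesian because it is a direct sum of almost cartesian squares, and so it remains to show that the right hand square is almost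
cartesian. The image of the top-right map contains `ψ₀, …, ψ_{n−1}, ψ̄` and, hence, is onto. Since the vertical maps are both onto, this shows
that all the maps in the square are onto. The elements `π₀, π₁, …, π_{n−1}, π̄` of `X^*(P^K)` are linearly independent.  Therefore, an element
`ψ = Σ a_iψ_i + aψ̄` of `X^*(S^K)` maps to zero in `X^*(P^K)` if and only if `a = 0` and `Σ_{dj ⩽ i < d(j+1)} a_i = 0` for `j = 0, …, (n/d) − 1`.
The first condition implies that `ψ ∈ ℤ[Γ]ψ₀`, and the second condition implies that it lies in the kernel of `ℤ[Γ]ψ₀ → ℤ[Γ/D]π₀`. We can now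
apply Lemma 6.3.»

THE MODEL (dictionary).  `Γ`, `ι`, `Γ₀`, `D` as in `Setting` (g17-#2); `R[Γ] = Γ →₀ R`, `R[Γ/D] = Γ ⧸ D →₀ R`.
* `X^*(S^K)` = **`serreLattice ι R`** = `{f ∈ R[Γ] | f(γ) + f(ιγ) independent of γ}` («natural inclusion»; = skel-3's `infinityTypes Γ Γ ι`
  read in `R[Γ]`, `mem_serreLattice_iff`); `s^K = onesFun = Σ_γ γ`; `ψ_τ = psi` (g17-#2), `ψ̄ = psiBar = Σ_{τ∈Γ₀} ιτ` (= skel-3's `milneBar Γ₀`,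
  `psiBar_apply_eq_milneBar`); Lemma 3.3 in the form used: **`eq_sum_psi_add_psiBar`** (`f = Σ_{τ∈Γ₀} f(τ)ψ_τ + (c_f − Σ_τ f(τ))ψ̄`).
* `X^*(α) : X^*(S^K) → X^*(P^K) ↪ ℤ[Γ/D]` = **`alphaS`** = `pushFun (↑)` on `serreLattice` («`Σ f(τ)τ ↦ Σ f(τ)(τD)`»); `X^*(P^K)` = its image
  **`weilLattice`** (`P^K → S^K` is injective, Remark 5.2 (a), so `X^*(α)` is onto), `alphaP` the corestriction; **`alphaS_eq_zero_iff`** («maps to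
  zero in `X^*(P^K)` iff `a = 0` and `Σ_{dj ⩽ i < d(j+1)} a_i = 0`»: `f(1) + f(ι) = 0` and the sums of `f` over the cosets `τD ⊂ Γ₀` vanish).
* `X^*(T^Ψ)` = `CharModule R Γ ι` (`Ψ = Γψ₀ ≅ Γ`), `X^*(γ) = `**`gammaPsi`** (`[δ_γ] ↦ γψ₀`, Milne's `f ↦ Σ f(ψ)ψ`, by g15-#1 `liftChar` since
  `ψ + ιψ = s^K`); `X^*(T^Ψ̄)` = `CharModule R (Γ ⧸ Γ₀) ι` (`Ψ̄ = {ψ̄, ιψ̄} ≅ Γ/Γ₀`), `X^*(γ̄) = `**`gammaBar`** (`[Γ₀] ↦ ψ̄`, `[ιΓ₀] ↦ ιψ̄`, via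
  `cosetCompl`).
* `X^*(L^Π)` = `CharModule R (Γ ⧸ D) ι` (`Π ≅ Γ/D`, «`τ ↦ τπ₀` defines a bijection `Γ/D → Π`»), `X^*(β) = `**`betaPi`** (`[τD] ↦ f_{τπ₀} =
  push(τψ₀)`, the function `germ : Γ/D → R[Γ/D]`); `X^*(L^Π̄)` = `CharModule R (Γ ⧸ Γ₀) ι`, `X^*(β̄) = `**`betaBar`** (`[π̄] ↦ f_π̄ = push(ψ̄) =
  dΣ ισ_i`).  LEMMA 6.7 ⇒ **`betaPi_injective`** (g17-#2 `injective_of_hasPrintedValues`, `|Γ₀| ≠ 2`); LEMMA 6.8 = **`betaBar_injective`**.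
* `X^*(α′) : X^*(T^Ψ) → X^*(L^Π)` = `OrbitTorus.push` along `Γ → Γ/D`, and `X^*(T^Ψ̄) → X^*(L^Π̄)` = identity (`ψ̄ ↦ π̄`).
* LEMMA 6.9's square: `topMap = X^*(γ) + X^*(γ̄)`, `leftMap = X^*(α′) ⊕ 1`, `bottomMap = X^*(β) + X^*(β̄)` (into `weilLattice`), right arrow `alphaP`;
  **`isAlmostCartesian_square`** via g16-#8's LEMMA 6.3 (c) (`Ker(leftMap) → Ker(rightMap)` onto, which is the displayed computation); the
  factorisation through `ℤ[Γ]ψ₀ ⊕ ℤ[Γ]ψ̄` of the printed proof is not needed for (c) and is not built.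

WHAT IS HERE (all PROVED): §1 `act_apply`, `Setting.mul_not_mem`/`mul_mem`, DEF `onesFun` (`onesFun_apply`, `act_onesFun`,
`pushFun_onesFun_apply`), DEF **`serreLattice`** (`mem_serreLattice_iff`, `act_mem_serreLattice`, `onesFun_mem_serreLattice`),
**`psi_add_act_iota_psi`** (`ψ + ιψ = s^K`), `psi_mem_serreLattice`, DEF **`psiBar`** (`psiBar_apply`, **`psiBar_apply_eq_milneBar`**, `act_psiBar`,
`psiBar_add_act_iota_psiBar`, `psiBar_mem_serreLattice`, `pushFun_psiBar`), **`eq_sum_psi_add_psiBar`** (Lemma 3.3 as used); §2 `pushFun_apply_coe`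
(`push(f)(γD) = Σ_{δ∈γD} f(δ)`), `filter_filter_coe_eq`, DEF **`alphaS`** (`alphaS_apply`), DEF **`weilLattice`**, DEF `alphaP` (`alphaP_surjective`,
`coe_alphaP`), **`alphaS_eq_zero_iff`**; §3 DEF **`gammaPsi`** (`gammaPsi_mk_single`, `gammaPsi_mem`), DEF `cosetCompl` (`cosetCompl_apply`,
`coe_eq_or`, `cosetCompl_one_eq_psiBar`, `act_iota_cosetCompl`, `cosetCompl_add_cosetCompl_smul`, `cosetCompl_mem_serreLattice`), DEF **`gammaBar`**
(`gammaBar_mk_single`, `gammaBar_mem`), DEF `germ` (`germ_coe`, `germ_add_germ_smul`), DEF **`betaPi`** (`betaPi_mk_single`, `hasPrintedValues_betaPi`,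
**`betaPi_injective`** — LEMMA 6.7's conclusion), DEF **`betaBar`** (`betaBar_mk_single`, `eq_single_add_single`, **`betaBar_injective`** — LEMMA 6.8);
§4 DEF **`topMap`** (`coe_topMap`), DEF **`leftMap`** (`leftMap_apply`), `coprod_beta_mem`, DEF **`bottomMap`** (`coe_bottomMap`), the right arrow being
`alphaP`; `betaPi_push_mk` / `betaBar_mk` (Lemma 6.2 for `Ψ`, `Ψ̄`), **`square_comm`**, `gammaPsi_mk_sum`, `pushFun_sum_smul_single`,
**`topMap_surjective`**, `leftMap_surjective`, **`bottomMap_surjective`**, **`isAlmostCartesian_square`** (LEMMA 6.9), **`int_isAlmostCartesian_square`**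
(`R = ℤ`).

NOT here: LEMMA 6.10 and the final diagram (sums over ALL `Γ`-orbits of CM types / of `W^K_{1,+}(p^∞)`, `X^*(T^K)`, `X^*(L^K)`) and THEOREM 6.1
itself (Layer B, B5-09); the number-theoretic instance (`K = Q·F`, the g16 carriers).

## References

* [Milne1999] J. S. Milne, *Lefschetz motives and the Tate conjecture*, Compositio Math. 117 (1999) 45–76 — §6 pp. 69–71, Lemmas 6.7, 6.8, 6.9
  (held `paper:doi-10-1023-a-1000776613765` p0025 L18–L60, p0026, p0027 L1–L22); §3 Lemma 3.3; §5 Lemma 5.1, Remark 5.2 (a).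
* [MilneCM2006] J. S. Milne, *Complex Multiplication* (course notes), Ch. I §4 Prop. 4.12 (the basis `{ψ_i} ∪ {φ̄}`; skel-3 `SerreGroupCharacters`).

Provenance: lane `lit-hodgefound`, seat `lit-hodgefound-p27` gen 17 (agent `literature-prover-lit-hodgefound-p27-g17-0`), row g17-#3.
-/

set_option autoImplicit false

noncomputable section

namespace Literature.NumberTheory.ComplexMultiplication

namespace CosetGerm

open Finset BlockOnesMatrix OrbitTorus AlmostCartesian

variable {Γ : Type*} [Group Γ] {ι : Γ} {Γ₀ D : Subgroup Γ}
variable [Fintype Γ] [DecidableEq Γ] [DecidablePred (· ∈ Γ₀)] [DecidablePred (· ∈ D)]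
variable (R : Type*) [CommRing R]

/-! ### §1 `X^*(S^K) ⊂ R[Γ]`, `s^K`, `ψ_τ`, `ψ̄`, and Lemma 3.3 in the form used -/

omit [Fintype Γ] [DecidableEq Γ] [DecidablePred (· ∈ Γ₀)] [DecidablePred (· ∈ D)] in
/-- Translation on `R[Γ]`: `(gf)(x) = f(g⁻¹x)`. [cite: Milne1999, §2 p. 55 L38–L47] -/
theorem act_apply (g : Γ) (f : Γ →₀ R) (x : Γ) : act R g f x = f (g⁻¹ * x) := by
  have : x = g • (g⁻¹ * x) := by rw [smul_eq_mul, mul_inv_cancel_left]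
  conv_lhs => rw [this]
  rw [act, Finsupp.lmapDomain_apply, Finsupp.mapDomain_apply (MulAction.injective g)]

omit [Fintype Γ] [DecidableEq Γ] [DecidablePred (· ∈ Γ₀)] [DecidablePred (· ∈ D)] in
/-- `x ∈ Γ₀ ⇒ ιx ∉ Γ₀`. [cite: Milne1999, §6 p. 69 L1–L8] -/
theorem Setting.mul_not_mem (h : Setting ι Γ₀ D) {x : Γ} (hx : x ∈ Γ₀) : ι * x ∉ Γ₀ :=
  fun h' => (h.isCMTypeWith.mem_iff x).1 hx h'

omit [Fintype Γ] [DecidableEq Γ] [DecidablePred (· ∈ Γ₀)] [DecidablePred (· ∈ D)] in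
/-- `x ∉ Γ₀ ⇒ ιx ∈ Γ₀`. [cite: Milne1999, §6 p. 69 L1–L8] -/
theorem Setting.mul_mem (h : Setting ι Γ₀ D) {x : Γ} (hx : x ∉ Γ₀) : ι * x ∈ Γ₀ :=
  (h.mem_or_mem x).resolve_left hx

/-- **`s^K = Σ_γ γ`**, the all-ones function (`ψ + ιψ` for every CM type `ψ`). [cite: Milne1999, §3 p. 59 L5–L6] -/
def onesFun : Γ →₀ R := ∑ g : Γ, Finsupp.single g 1

omit [Group Γ] [DecidableEq Γ] [DecidablePred (· ∈ Γ₀)] [DecidablePred (· ∈ D)] in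
/-- [cite: Milne1999, §3 p. 59 L5–L6] -/
@[simp] theorem onesFun_apply (x : Γ) : onesFun R x = (1 : R) := by
  classical
  rw [onesFun, Finsupp.finsetSum_apply]
  simp [Finsupp.single_apply]

omit [DecidableEq Γ] [DecidablePred (· ∈ Γ₀)] [DecidablePred (· ∈ D)] in
/-- `s^K` is translation invariant. [cite: Milne1999, §3 p. 59 L5–L6] -/
theorem act_onesFun (g : Γ) : act R g (onesFun R : Γ →₀ R) = onesFun R := by
  ext x
  rw [act_apply, onesFun_apply, onesFun_apply]

omit [DecidableEq Γ] [DecidablePred (· ∈ Γ₀)] in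
/-- `push(s^K) = d · Σ_c c` on `Γ/D` (each coset has `d` elements). [cite: Milne1999, §6 p. 69 L10–L21] -/
theorem pushFun_onesFun_apply (c : Γ ⧸ D) : pushFun R ((↑) : Γ → Γ ⧸ D) (onesFun R) c = (Fintype.card D : R) := by
  induction c using QuotientGroup.induction_on with | H γ => ?_
  rw [onesFun, map_sum, Finsupp.finsetSum_apply]
  simp_rw [pushFun_single, Finsupp.single_apply]
  rw [Finset.sum_boole, card_filter_coe_eq]

variable (ι) in
/-- **`X^*(S^K) ⊂ ℤ[Γ]`** («natural inclusion»): the `f ∈ R[Γ]` with `f(γ) + f(ιγ)` independent of `γ` (the Serre condition for a CM field;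
skel-3's `infinityTypes` with `E = Γ`). [cite: Milne1999, §6 p. 69 L18–L21; §3 Lemma 3.3] -/
def serreLattice : Submodule R (Γ →₀ R) where
  carrier := {f | ∀ γ : Γ, f γ + f (ι * γ) = f 1 + f ι}
  add_mem' := by
    intro f g hf hg γ
    simp only [Finsupp.add_apply]
    linear_combination hf γ + hg γ
  zero_mem' := fun γ => by simp
  smul_mem' := by
    intro r f hf γ
    simp only [Finsupp.smul_apply, smul_eq_mul]
    rw [← mul_add, hf γ, mul_add]

omit [Fintype Γ] [DecidableEq Γ] [DecidablePred (· ∈ Γ₀)] [DecidablePred (· ∈ D)] in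
/-- [cite: Milne1999, §6 p. 69 L18–L21] -/
theorem mem_serreLattice_iff (f : Γ →₀ R) : f ∈ serreLattice ι R ↔ ∀ γ : Γ, f γ + f (ι * γ) = f 1 + f ι := Iff.rfl

omit [Fintype Γ] [DecidableEq Γ] [DecidablePred (· ∈ Γ₀)] [DecidablePred (· ∈ D)] in
/-- `X^*(S^K)` is stable under translation (`ι` central): `(gf)(x) + (gf)(ιx) = f(g⁻¹x) + f(ιg⁻¹x)`. [cite: Milne1999, §6 p. 69 L22–L26] -/
theorem act_mem_serreLattice (h : Setting ι Γ₀ D) (g : Γ) {f : Γ →₀ R} (hf : f ∈ serreLattice ι R) : act R g f ∈ serreLattice ι R := by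
  intro γ
  rw [act_apply, act_apply, act_apply, act_apply, mul_one, ← mul_assoc, ← h.comm g⁻¹, mul_assoc, hf, ← hf g⁻¹]

omit [DecidableEq Γ] [DecidablePred (· ∈ Γ₀)] [DecidablePred (· ∈ D)] in
/-- `s^K ∈ X^*(S^K)`. [cite: Milne1999, §3 p. 59 L5–L6] -/
theorem onesFun_mem_serreLattice : (onesFun R : Γ →₀ R) ∈ serreLattice ι R := fun γ => by simp

omit [DecidablePred (· ∈ D)] in
/-- **`ψ_τ + ιψ_τ = s^K`** (`τ ∈ Γ₀`): a CM type and its conjugate cover `Γ`. [cite: Milne1999, §3 p. 59 L5–L6; §6 p. 69 L22–L24] -/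
theorem psi_add_act_iota_psi (h : Setting ι Γ₀ D) {τ : Γ} (hτ : τ ∈ Γ₀) : psi ι Γ₀ R τ + act R ι (psi ι Γ₀ R τ) = onesFun R := by
  have hιinv : ι⁻¹ = ι := inv_eq_of_mul_eq_one_right h.mul_self
  have hιι : ∀ y : Γ, ι * (ι * y) = y := fun y => by rw [← mul_assoc, h.mul_self, one_mul]
  ext x
  rw [Finsupp.add_apply, act_apply, hιinv, psi_apply R h, psi_apply R h, hιι, onesFun_apply]
  by_cases hx : x ∈ Γ₀
  · have hιx : ι * x ∉ Γ₀ := h.mul_not_mem hx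
    have hne : τ ≠ ι * x := fun e => hιx (e ▸ hτ)
    rw [if_neg (show ¬(ι * x ≠ τ ∧ ι * x ∈ Γ₀) from fun hh => hιx hh.2), if_neg hne]
    by_cases hxt : τ = x
    · rw [if_pos hxt, if_neg (show ¬(x ≠ τ ∧ x ∈ Γ₀) from fun hh => hh.1 hxt.symm)]; ring
    · rw [if_neg hxt, if_pos (show x ≠ τ ∧ x ∈ Γ₀ from ⟨Ne.symm hxt, hx⟩)]; ring
  · have hιx : ι * x ∈ Γ₀ := h.mul_mem hx
    have hne : τ ≠ x := fun e => hx (e ▸ hτ)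
    rw [if_neg hne, if_neg (show ¬(x ≠ τ ∧ x ∈ Γ₀) from fun hh => hx hh.2)]
    by_cases hyt : ι * x = τ
    · rw [if_neg (show ¬(ι * x ≠ τ ∧ ι * x ∈ Γ₀) from fun hh => hh.1 hyt), if_pos hyt.symm]; ring
    · rw [if_pos (show ι * x ≠ τ ∧ ι * x ∈ Γ₀ from ⟨hyt, hιx⟩), if_neg (Ne.symm hyt)]; ring

omit [DecidablePred (· ∈ D)] in
/-- **`ψ_τ ∈ X^*(S^K)`** (`τ ∈ Γ₀`). [cite: Milne1999, §6 p. 69 L22–L24] -/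
theorem psi_mem_serreLattice (h : Setting ι Γ₀ D) {τ : Γ} (hτ : τ ∈ Γ₀) : psi ι Γ₀ R τ ∈ serreLattice ι R := by
  have hιinv : ι⁻¹ = ι := inv_eq_of_mul_eq_one_right h.mul_self
  have e : ∀ γ : Γ, psi ι Γ₀ R τ γ + psi ι Γ₀ R τ (ι * γ) = 1 := fun γ => by
    have := DFunLike.congr_fun (psi_add_act_iota_psi R h hτ) (ι * γ)
    rw [Finsupp.add_apply, act_apply, hιinv, ← mul_assoc, h.mul_self, one_mul, onesFun_apply] at this
    rwa [add_comm] at this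
  have e1 := e 1
  rw [mul_one] at e1
  intro γ
  rw [e γ, e1]

variable (ι Γ₀) in
/-- **`ψ̄ = Σ_{τ∈Γ₀} ιτ ∈ ℤ[Γ]`** (the conjugate of the CM type `Γ₀`; skel-3's `milneBar Γ₀`). [cite: Milne1999, §6 p. 69 L22–L23] -/
def psiBar : Γ →₀ R := ∑ τ ∈ univ.filter (· ∈ Γ₀), Finsupp.single (ι * τ) 1

omit [DecidablePred (· ∈ D)] in
/-- `ψ̄(x) = [ιx ∈ Γ₀]`. [cite: Milne1999, §6 p. 69 L22–L23] -/
theorem psiBar_apply (h : Setting ι Γ₀ D) (x : Γ) : psiBar ι Γ₀ R x = if ι * x ∈ Γ₀ then 1 else 0 := by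
  have hιι : ∀ y : Γ, ι * (ι * y) = y := fun y => by rw [← mul_assoc, h.mul_self, one_mul]
  have hiff : ∀ τ' : Γ, (ι * τ' = x) = (τ' = ι * x) := fun τ' =>
    propext ⟨fun e => by rw [← e, hιι], fun e => by rw [e, hιι]⟩
  rw [psiBar, Finsupp.finsetSum_apply]
  simp_rw [Finsupp.single_apply, hiff]
  rw [Finset.sum_ite_eq']
  simp only [Finset.mem_filter, Finset.mem_univ, true_and]

omit [DecidablePred (· ∈ D)] in
/-- **Dictionary: `ψ̄` is skel-3's `milneBar Γ₀`** (`= 𝟙_{Γ ∖ Γ₀}`). [cite: Milne1999, §6 p. 69 L22–L23] -/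
theorem psiBar_apply_eq_milneBar (h : Setting ι Γ₀ D) (x : Γ) : psiBar ι Γ₀ R x = (milneBar (Γ₀ : Set Γ) x : R) := by
  rw [psiBar_apply R h]
  by_cases hx : x ∈ Γ₀
  · rw [if_neg (h.mul_not_mem hx), IsCMTypeWith.milneBar_apply_of_mem (Φ := (Γ₀ : Set Γ)) (show x ∈ (Γ₀ : Set Γ) from hx), Int.cast_zero]
  · rw [if_pos (h.mul_mem hx), IsCMTypeWith.milneBar_apply_of_not_mem (Φ := (Γ₀ : Set Γ)) (show x ∉ (Γ₀ : Set Γ) from hx), Int.cast_one]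

omit [DecidablePred (· ∈ D)] in
/-- **«`τ_iψ̄ = ψ̄`»** for `τ ∈ Γ₀`. [cite: Milne1999, §6 p. 70 L23] -/
theorem act_psiBar (h : Setting ι Γ₀ D) {τ : Γ} (hτ : τ ∈ Γ₀) : act R τ (psiBar ι Γ₀ R) = psiBar ι Γ₀ R := by
  ext x
  rw [act_apply, psiBar_apply R h, psiBar_apply R h, show ι * (τ⁻¹ * x) = τ⁻¹ * (ι * x) by rw [← mul_assoc, h.comm τ⁻¹, mul_assoc]]
  have e : ι * x ∈ Γ₀ ↔ τ⁻¹ * (ι * x) ∈ Γ₀ :=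
    ⟨fun hx => Γ₀.mul_mem (Γ₀.inv_mem hτ) hx, fun hx => by simpa using Γ₀.mul_mem hτ hx⟩
  by_cases hx : ι * x ∈ Γ₀
  · rw [if_pos hx, if_pos (e.mp hx)]
  · rw [if_neg hx, if_neg (fun h' => hx (e.mpr h'))]

omit [DecidablePred (· ∈ D)] in
/-- **`ψ̄ + ιψ̄ = s^K`** («`Ψ̄ = {ψ̄, ιψ̄}` is a `Γ`-orbit»; `ιψ̄ = Σ_{τ∈Γ₀} τ`). [cite: Milne1999, §6 p. 70 L23–L24] -/
theorem psiBar_add_act_iota_psiBar (h : Setting ι Γ₀ D) : psiBar ι Γ₀ R + act R ι (psiBar ι Γ₀ R) = onesFun R := by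
  have hιinv : ι⁻¹ = ι := inv_eq_of_mul_eq_one_right h.mul_self
  have hιι : ∀ y : Γ, ι * (ι * y) = y := fun y => by rw [← mul_assoc, h.mul_self, one_mul]
  ext x
  rw [Finsupp.add_apply, act_apply, hιinv, psiBar_apply R h, psiBar_apply R h, hιι, onesFun_apply]
  by_cases hx : x ∈ Γ₀
  · rw [if_neg (h.mul_not_mem hx), if_pos hx, zero_add]
  · rw [if_pos (h.mul_mem hx), if_neg hx, add_zero]

omit [DecidablePred (· ∈ D)] in
/-- **`ψ̄ ∈ X^*(S^K)`.** [cite: Milne1999, §6 p. 69 L22–L24] -/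
theorem psiBar_mem_serreLattice (h : Setting ι Γ₀ D) : psiBar ι Γ₀ R ∈ serreLattice ι R := by
  have hιinv : ι⁻¹ = ι := inv_eq_of_mul_eq_one_right h.mul_self
  have e : ∀ γ : Γ, psiBar ι Γ₀ R γ + psiBar ι Γ₀ R (ι * γ) = 1 := fun γ => by
    have := DFunLike.congr_fun (psiBar_add_act_iota_psiBar R h) (ι * γ)
    rw [Finsupp.add_apply, act_apply, hιinv, ← mul_assoc, h.mul_self, one_mul, onesFun_apply] at this
    rwa [add_comm] at this
  have e1 := e 1
  rw [mul_one] at e1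
  intro γ
  rw [e γ, e1]

omit [DecidableEq Γ] in
/-- **`push(ψ̄) = dΣ_i ισ_i`** (`= f_π̄`; each `ισ_i` is hit by the `d` elements of the coset). [cite: Milne1999, §6 p. 70 L23–L25, p. 71 L12] -/
theorem pushFun_psiBar (h : Setting ι Γ₀ D) :
    pushFun R ((↑) : Γ → Γ ⧸ D) (psiBar ι Γ₀ R) = (Fintype.card D : R) • ∑ k : ↥(halfCosets Γ₀ D), Finsupp.single (ι • (k : Γ ⧸ D)) 1 := by
  have key : ∑ τ' ∈ univ.filter (· ∈ Γ₀), Finsupp.single (ι • (τ' : Γ ⧸ D)) (1 : R) =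
      ∑ c ∈ halfCosets Γ₀ D, (Fintype.card D : R) • Finsupp.single (ι • c) 1 := by
    refine (Finset.sum_image' _ fun τ₁ hτ₁ => ?_).symm
    rw [Finset.sum_congr rfl fun τ' hτ' => by rw [(mem_filter.mp hτ').2], sum_const,
      card_filter_mem_coe_eq h.le (mem_filter.mp hτ₁).2, Nat.cast_smul_eq_nsmul]
  rw [psiBar, map_sum]
  simp_rw [pushFun_single, show ∀ γ : Γ, ((ι * γ : Γ) : Γ ⧸ D) = ι • (γ : Γ ⧸ D) from fun γ => rfl]
  rw [key, ← Finset.smul_sum, ← Finset.sum_coe_sort]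

omit [DecidablePred (· ∈ D)] in
/-- **LEMMA 3.3 as used**: every `f ∈ X^*(S^K)` is `Σ_{τ∈Γ₀} f(τ)ψ_τ + (c_f − Σ_{τ∈Γ₀} f(τ))ψ̄`, `c_f = f(1) + f(ι)` («`ψ₀, …, ψ_{n−1}, ψ̄` form a
basis for `X^*(S^K)`»; Milne's `ψ = Σ a_iψ_i + aψ̄`). [cite: Milne1999, §6 p. 69 L22–L24 (Lemma 3.3); p. 71 L13] -/
theorem eq_sum_psi_add_psiBar (h : Setting ι Γ₀ D) {f : Γ →₀ R} (hf : f ∈ serreLattice ι R) :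
    f = ∑ τ ∈ univ.filter (· ∈ Γ₀), f τ • psi ι Γ₀ R τ +
      (f 1 + f ι - ∑ τ ∈ univ.filter (· ∈ Γ₀), f τ) • psiBar ι Γ₀ R := by
  have hιι : ∀ y : Γ, ι * (ι * y) = y := fun y => by rw [← mul_assoc, h.mul_self, one_mul]
  ext x
  simp only [Finsupp.add_apply, Finsupp.finsetSum_apply, Finsupp.smul_apply, smul_eq_mul, psiBar_apply R h, psi_apply R h, mul_add,
    Finset.sum_add_distrib, mul_ite, mul_one, mul_zero]
  rw [Finset.sum_ite_eq']
  by_cases hx : x ∈ Γ₀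
  · have hιx : ι * x ∉ Γ₀ := h.mul_not_mem hx
    rw [if_pos (mem_filter.mpr ⟨mem_univ _, hx⟩), if_neg hιx,
      Finset.sum_eq_zero fun τ _ => if_neg (show ¬(ι * x ≠ τ ∧ ι * x ∈ Γ₀) from fun hh => hιx hh.2), add_zero, add_zero]
  · have hιx : ι * x ∈ Γ₀ := h.mul_mem hx
    have hs2 : (∑ τ ∈ univ.filter (· ∈ Γ₀), if ι * x ≠ τ ∧ ι * x ∈ Γ₀ then f τ else 0) =
        ∑ τ ∈ univ.filter (· ∈ Γ₀), f τ - f (ι * x) := by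
      simp only [hιx, and_true]
      rw [← Finset.sum_filter, Finset.filter_ne, Finset.sum_erase_eq_sub (mem_filter.mpr ⟨mem_univ _, hιx⟩)]
    rw [if_neg (fun hh => hx (mem_filter.mp hh).2), zero_add, if_pos hιx, hs2]
    have := hf (ι * x)
    rw [hιι] at this
    linear_combination this

/-! ### §2 `X^*(α) = push` on `X^*(S^K)`, `X^*(P^K)` as its image, and the kernel -/

omit [DecidableEq Γ] [DecidablePred (· ∈ Γ₀)] in
/-- `push(f)(γD) = Σ_{δ ∈ γD} f(δ)`. [cite: Milne1999, §6 p. 69 L20–L21 («`Σ f(τ)τ ↦ Σ f(τ)(τD)`»)] -/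
theorem pushFun_apply_coe (f : Γ →₀ R) (γ : Γ) :
    pushFun R ((↑) : Γ → Γ ⧸ D) f (γ : Γ ⧸ D) = ∑ δ ∈ univ.filter (fun g : Γ => (g : Γ ⧸ D) = (γ : Γ ⧸ D)), f δ := by
  classical
  induction f using Finsupp.induction_linear with
  | zero => simp
  | add f₁ f₂ h₁ h₂ => rw [map_add, Finsupp.add_apply, h₁, h₂, ← Finset.sum_add_distrib]; rfl
  | single g r =>
    rw [pushFun_single]
    simp only [Finsupp.single_apply, Finset.sum_ite_eq, Finset.mem_filter, Finset.mem_univ, true_and]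

omit [DecidableEq Γ] in
/-- For `D ⊂ Γ₀`, `τ ∈ Γ₀`: the elements of `Γ₀` in the coset `τD` are all of `τD`. [cite: Milne1999, §6 p. 69 L10–L14] -/
theorem filter_filter_coe_eq (hD : D ≤ Γ₀) {τ : Γ} (hτ : τ ∈ Γ₀) :
    ((univ.filter (· ∈ Γ₀)).filter fun g : Γ => (g : Γ ⧸ D) = (τ : Γ ⧸ D)) = univ.filter fun g : Γ => (g : Γ ⧸ D) = (τ : Γ ⧸ D) := by
  ext g
  simp only [mem_filter, mem_univ, true_and, and_iff_right_iff_imp]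
  intro e
  rw [QuotientGroup.eq] at e
  have := Γ₀.mul_mem hτ (Γ₀.inv_mem (hD e))
  rwa [mul_inv_rev, inv_inv, mul_inv_cancel_left] at this

variable (ι D) in
/-- **`X^*(α) : X^*(S^K) → ℤ[Γ/D]`, `Σ f(τ)τ ↦ Σ f(τ)(τD)`** (Lemma 5.1's diagram: `X^*(α^K)` followed by the injection `π ↦ f_π`).
[cite: Milne1999, §6 p. 69 L18–L21] -/
def alphaS : serreLattice ι R →ₗ[R] (Γ ⧸ D →₀ R) :=
  (pushFun R ((↑) : Γ → Γ ⧸ D)).comp (serreLattice ι R).subtype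

omit [Fintype Γ] [DecidableEq Γ] [DecidablePred (· ∈ Γ₀)] [DecidablePred (· ∈ D)] in
/-- [cite: Milne1999, §6 p. 69 L18–L21] -/
@[simp] theorem alphaS_apply (f : serreLattice ι R) : alphaS ι D R f = pushFun R ((↑) : Γ → Γ ⧸ D) (f : Γ →₀ R) := rfl

variable (ι D) in
/-- **`X^*(P^K) ⊂ ℤ[Γ/D]`** modelled as the image of `X^*(α)` (`π ↦ f_π` is injective, §4, and `X^*(α)` is onto since `α : P^K → S^K` is
injective, Remark 5.2 (a)). [cite: Milne1999, §6 p. 69 L18–L21, p. 70 L9–L10, p. 71 L10–L11] -/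
def weilLattice : Submodule R (Γ ⧸ D →₀ R) := LinearMap.range (alphaS ι D R)

variable (ι D) in
/-- `X^*(α)` with target `X^*(P^K)` (onto). [cite: Milne1999, §6 p. 71 L10–L11 («the vertical maps are both onto»)] -/
def alphaP : serreLattice ι R →ₗ[R] weilLattice ι D R := (alphaS ι D R).rangeRestrict

omit [Fintype Γ] [DecidableEq Γ] [DecidablePred (· ∈ Γ₀)] [DecidablePred (· ∈ D)] in
/-- [cite: Milne1999, §6 p. 71 L10–L11] -/
theorem alphaP_surjective : Function.Surjective (alphaP ι D R) := LinearMap.surjective_rangeRestrict _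

omit [Fintype Γ] [DecidableEq Γ] [DecidablePred (· ∈ Γ₀)] [DecidablePred (· ∈ D)] in
/-- [cite: Milne1999, §6 p. 71 L10–L11] -/
@[simp] theorem coe_alphaP (f : serreLattice ι R) : (alphaP ι D R f : Γ ⧸ D →₀ R) = pushFun R ((↑) : Γ → Γ ⧸ D) (f : Γ →₀ R) := rfl

omit [DecidableEq Γ] in
/-- **The kernel of `X^*(α)`**: for `d ≠ 0` in `R`, `f ∈ X^*(S^K)` maps to zero iff `f(1) + f(ι) = 0` and `Σ_{δ∈τD} f(δ) = 0` for every `τ ∈ Γ₀`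
(«an element `ψ = Σ a_iψ_i + aψ̄` maps to zero iff `a = 0` and `Σ_{dj ⩽ i < d(j+1)} a_i = 0`»: here `a_i = f(τ_i)`, `a = c_f − Σ a_i`, and
`push(f)(τD) = Σ_{τ_i ∈ τD} a_i`, `push(f)(ιτD) = d·c_f − Σ_{τ_i∈τD} a_i`). [cite: Milne1999, §6 p. 71 L12–L14 (proof of Lemma 6.9)] -/
theorem alphaS_eq_zero_iff [NoZeroDivisors R] (h : Setting ι Γ₀ D) (hd : (Fintype.card D : R) ≠ 0) {f : Γ →₀ R}
    (hf : f ∈ serreLattice ι R) :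
    pushFun R ((↑) : Γ → Γ ⧸ D) f = 0 ↔
      (∀ τ ∈ Γ₀, ∑ δ ∈ univ.filter (fun g : Γ => (g : Γ ⧸ D) = (τ : Γ ⧸ D)), f δ = 0) ∧ f 1 + f ι = 0 := by
  -- the value on the conjugate coset: `push(f)(ιτD) = d c_f − push(f)(τD)`
  have conj : ∀ τ : Γ, pushFun R ((↑) : Γ → Γ ⧸ D) f ((ι * τ : Γ) : Γ ⧸ D) =
      (Fintype.card D : R) * (f 1 + f ι) - pushFun R ((↑) : Γ → Γ ⧸ D) f (τ : Γ ⧸ D) := by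
    intro τ
    rw [pushFun_apply_coe, pushFun_apply_coe]
    have hbij : ∑ δ ∈ univ.filter (fun g : Γ => (g : Γ ⧸ D) = ((ι * τ : Γ) : Γ ⧸ D)), f δ =
        ∑ δ ∈ univ.filter (fun g : Γ => (g : Γ ⧸ D) = (τ : Γ ⧸ D)), f (ι * δ) := by
      refine (Finset.sum_equiv (Equiv.mulLeft ι) (fun δ => ?_) (fun δ _ => rfl)).symm
      simp only [mem_filter, mem_univ, true_and, Equiv.coe_mulLeft, QuotientGroup.eq, mul_inv_rev,
        inv_eq_of_mul_eq_one_right h.mul_self]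
      rw [mul_assoc, ← mul_assoc ι ι τ, h.mul_self, one_mul]
    rw [hbij, Finset.sum_congr rfl fun δ _ => show f (ι * δ) = (f 1 + f ι) - f δ by rw [← hf δ]; ring,
      Finset.sum_sub_distrib, Finset.sum_const, card_filter_coe_eq, nsmul_eq_mul]
  constructor
  · intro H
    have H1 : ∀ τ : Γ, ∑ δ ∈ univ.filter (fun g : Γ => (g : Γ ⧸ D) = (τ : Γ ⧸ D)), f δ = 0 := fun τ => by
      rw [← pushFun_apply_coe, H, Finsupp.zero_apply]
    refine ⟨fun τ _ => H1 τ, ?_⟩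
    have := conj 1
    rw [H, Finsupp.zero_apply, Finsupp.zero_apply, sub_zero] at this
    exact (mul_eq_zero.mp this.symm).resolve_left hd
  · rintro ⟨H1, H2⟩
    ext c
    obtain ⟨s, rfl⟩ := (frame h).surjective c
    rcases s with k | k
    · obtain ⟨τ, hτ, hk⟩ := exists_rep_of_mem_halfCosets k.2
      rw [frame_inl, ← hk, pushFun_apply_coe, H1 τ hτ, Finsupp.zero_apply]
    · obtain ⟨τ, hτ, hk⟩ := exists_rep_of_mem_halfCosets k.2
      rw [frame_inr, ← hk, Finsupp.zero_apply]
      change pushFun R ((↑) : Γ → Γ ⧸ D) f ((ι * τ : Γ) : Γ ⧸ D) = 0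
      rw [conj, H2, mul_zero, zero_sub, neg_eq_zero, pushFun_apply_coe, H1 τ hτ]

/-! ### §3 The maps `X^*(γ)`, `X^*(γ̄)`, `X^*(β)`, `X^*(β̄)`; LEMMA 6.7's conclusion and LEMMA 6.8 -/

section Maps

variable [NoZeroDivisors R] (h : Setting ι Γ₀ D) (h2 : (2 : R) ≠ 0)

include h h2

/-- **`X^*(γ) : X^*(T^Ψ) → ℤ[Γ]`, `[δ_γ] ↦ γψ₀`** (Milne's `f ↦ Σ_{ψ∈Ψ} f(ψ)ψ`, `Ψ = Γψ₀ ≅ Γ`; well defined on `X^*(T^Ψ) = ℤ[Ψ]/{f = ιf, Σ f = 0}`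
because `ψ + ιψ = s^K` — g15-#1 `liftChar`). [cite: Milne1999, §3 p. 59 L3–L5; §6 p. 70 L1 (Lemma 6.7, top arrow)] -/
def gammaPsi : CharModule R Γ ι →ₗ[R] (Γ →₀ R) :=
  liftChar R ι (IsRegular.of_ne_zero h2) (fun g : Γ => act R g (psi ι Γ₀ R 1)) (onesFun R) fun g => by
    rw [smul_eq_mul, h.comm g, act_mul, LinearMap.comp_apply, ← map_add, psi_add_act_iota_psi R h Γ₀.one_mem, act_onesFun]

omit [DecidablePred (· ∈ D)] in
/-- `X^*(γ)[δ_γ] = γψ₀`. [cite: Milne1999, §6 p. 70 L1] -/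
theorem gammaPsi_mk_single (g : Γ) :
    gammaPsi R h h2 (Submodule.Quotient.mk (Finsupp.single g 1)) = act R g (psi ι Γ₀ R 1) :=
  liftChar_mk_single R ι _ _ _ _ g

omit [DecidablePred (· ∈ D)] in
/-- `X^*(γ)` lands in `X^*(S^K)`. [cite: Milne1999, §6 p. 70 L1] -/
theorem gammaPsi_mem (x : CharModule R Γ ι) : gammaPsi R h h2 x ∈ serreLattice ι R := by
  induction x using Submodule.Quotient.induction_on with | H f => ?_
  rw [gammaPsi, liftChar_mk, Finsupp.linearCombination_apply, Finsupp.sum]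
  exact Submodule.sum_mem _ fun g _ => Submodule.smul_mem _ _ (act_mem_serreLattice R h g (psi_mem_serreLattice R h Γ₀.one_mem))

omit [NoZeroDivisors R] h h2 in
/-- The indicator `Σ_{g ∉ c} g ∈ ℤ[Γ]` of the complement of a coset `c ∈ Γ/Γ₀` (`c = Γ₀ ↦ ψ̄`, `c = ιΓ₀ ↦ ιψ̄`). [cite: Milne1999, §6 p. 70
L23–L24] -/
def cosetCompl (c : Γ ⧸ Γ₀) : Γ →₀ R := ∑ g ∈ univ.filter (fun g : Γ => (g : Γ ⧸ Γ₀) ≠ c), Finsupp.single g 1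

omit [NoZeroDivisors R] [DecidablePred (· ∈ D)] h h2 in
/-- [cite: Milne1999, §6 p. 70 L23–L24] -/
theorem cosetCompl_apply (c : Γ ⧸ Γ₀) (x : Γ) : cosetCompl R c x = if (x : Γ ⧸ Γ₀) ≠ c then 1 else 0 := by
  rw [cosetCompl, Finsupp.finsetSum_apply]
  simp_rw [Finsupp.single_apply]
  rw [Finset.sum_ite_eq']
  simp only [Finset.mem_filter, Finset.mem_univ, true_and]

omit [Fintype Γ] [DecidableEq Γ] [DecidablePred (· ∈ Γ₀)] [DecidablePred (· ∈ D)] [NoZeroDivisors R] h2 in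
/-- `Γ/Γ₀ = {c, ιc}` for every `c`: each `x ∈ Γ` lies in `c` or in `ιc`. [cite: Milne1999, §6 p. 69 L1–L8 («`Γ = Γ₀ × ⟨ι⟩`»)] -/
theorem coe_eq_or (x : Γ) (c : Γ ⧸ Γ₀) : (x : Γ ⧸ Γ₀) = c ∨ (x : Γ ⧸ Γ₀) = ι • c := by
  induction c using QuotientGroup.induction_on with | H g => ?_
  rw [MulAction.Quotient.smul_coe, smul_eq_mul, QuotientGroup.eq, QuotientGroup.eq, ← mul_assoc, ← h.comm x⁻¹, mul_assoc]
  exact h.mem_or_mem (x⁻¹ * g)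

omit [NoZeroDivisors R] [DecidablePred (· ∈ D)] h2 in
/-- `cosetCompl Γ₀ = ψ̄`. [cite: Milne1999, §6 p. 70 L23–L24] -/
theorem cosetCompl_one_eq_psiBar : cosetCompl R ((1 : Γ) : Γ ⧸ Γ₀) = psiBar ι Γ₀ R := by
  ext x
  rw [cosetCompl_apply, psiBar_apply R h]
  by_cases hx : x ∈ Γ₀
  · have e : (x : Γ ⧸ Γ₀) = ((1 : Γ) : Γ ⧸ Γ₀) := QuotientGroup.eq.mpr (by rw [mul_one]; exact Γ₀.inv_mem hx)
    rw [if_neg (not_not.mpr e), if_neg (h.mul_not_mem hx)]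
  · have e : (x : Γ ⧸ Γ₀) ≠ ((1 : Γ) : Γ ⧸ Γ₀) := fun e => hx (by
      have := QuotientGroup.eq.mp e
      rw [mul_one] at this
      exact (Subgroup.inv_mem_iff Γ₀).mp this)
    rw [if_pos e, if_pos (h.mul_mem hx)]

omit [NoZeroDivisors R] [DecidablePred (· ∈ D)] h2 in
/-- `ι(cosetCompl c) = cosetCompl (ιc)`. [cite: Milne1999, §6 p. 70 L23–L24] -/
theorem act_iota_cosetCompl (c : Γ ⧸ Γ₀) : act R ι (cosetCompl R c) = cosetCompl R (ι • c) := by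
  have hιinv : ι⁻¹ = ι := inv_eq_of_mul_eq_one_right h.mul_self
  have hΓ₀ : Setting ι Γ₀ Γ₀ := ⟨h.comm, h.mul_self, h.not_mem, h.mem_or_mem, le_rfl⟩
  ext x
  rw [act_apply, cosetCompl_apply, cosetCompl_apply, hιinv]
  have e : ((ι * x : Γ) : Γ ⧸ Γ₀) ≠ c ↔ (x : Γ ⧸ Γ₀) ≠ ι • c := by
    rw [show ((ι * x : Γ) : Γ ⧸ Γ₀) = ι • (x : Γ ⧸ Γ₀) from rfl, not_iff_not]
    constructor
    · intro e; rw [← e, hΓ₀.smul_smul_eq]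
    · intro e; rw [e, hΓ₀.smul_smul_eq]
  simp only [e]

omit [NoZeroDivisors R] [DecidablePred (· ∈ D)] h2 in
/-- `cosetCompl c + cosetCompl (ιc) = s^K` (the two cosets partition `Γ`). [cite: Milne1999, §6 p. 70 L23–L24] -/
theorem cosetCompl_add_cosetCompl_smul (c : Γ ⧸ Γ₀) : cosetCompl R c + cosetCompl R (ι • c) = onesFun R := by
  have hΓ₀ : Setting ι Γ₀ Γ₀ := ⟨h.comm, h.mul_self, h.not_mem, h.mem_or_mem, le_rfl⟩
  ext x
  rw [Finsupp.add_apply, cosetCompl_apply, cosetCompl_apply, onesFun_apply]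
  rcases coe_eq_or h x c with e | e
  · rw [if_neg (not_not.mpr e), if_pos (show (x : Γ ⧸ Γ₀) ≠ ι • c by rw [e]; exact (hΓ₀.smul_ne_self c).symm), zero_add]
  · rw [if_pos (show (x : Γ ⧸ Γ₀) ≠ c by rw [e]; exact hΓ₀.smul_ne_self c), if_neg (not_not.mpr e), add_zero]

omit [NoZeroDivisors R] [DecidablePred (· ∈ D)] h2 in
/-- `cosetCompl c ∈ X^*(S^K)`. [cite: Milne1999, §6 p. 70 L23–L24] -/
theorem cosetCompl_mem_serreLattice (c : Γ ⧸ Γ₀) : cosetCompl R c ∈ serreLattice ι R := by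
  have hιinv : ι⁻¹ = ι := inv_eq_of_mul_eq_one_right h.mul_self
  have e : ∀ γ : Γ, cosetCompl R c γ + cosetCompl R c (ι * γ) = 1 := fun γ => by
    have := DFunLike.congr_fun (cosetCompl_add_cosetCompl_smul R h c) γ
    rw [Finsupp.add_apply, ← act_iota_cosetCompl R h, act_apply, hιinv, onesFun_apply] at this
    exact this
  have e1 := e 1
  rw [mul_one] at e1
  intro γ
  rw [e γ, e1]

/-- **`X^*(γ̄) : X^*(T^Ψ̄) → ℤ[Γ]`, `[Γ₀] ↦ ψ̄`, `[ιΓ₀] ↦ ιψ̄`** (`Ψ̄ = {ψ̄, ιψ̄} ≅ Γ/Γ₀`). [cite: Milne1999, §6 p. 70 L23–L26 (Lemma 6.8, top arrow)] -/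
def gammaBar : CharModule R (Γ ⧸ Γ₀) ι →ₗ[R] (Γ →₀ R) :=
  liftChar R ι (IsRegular.of_ne_zero h2) (fun c => cosetCompl R c) (onesFun R) fun c => cosetCompl_add_cosetCompl_smul R h c

omit [DecidablePred (· ∈ D)] in
/-- `X^*(γ̄)[δ_c] = cosetCompl c`. [cite: Milne1999, §6 p. 70 L23–L26] -/
theorem gammaBar_mk_single (c : Γ ⧸ Γ₀) :
    gammaBar R h h2 (Submodule.Quotient.mk (Finsupp.single c 1)) = cosetCompl R c :=
  liftChar_mk_single R ι _ _ _ _ c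

omit [DecidablePred (· ∈ D)] in
/-- `X^*(γ̄)` lands in `X^*(S^K)`. [cite: Milne1999, §6 p. 70 L23–L26] -/
theorem gammaBar_mem (x : CharModule R (Γ ⧸ Γ₀) ι) : gammaBar R h h2 x ∈ serreLattice ι R := by
  induction x using Submodule.Quotient.induction_on with | H f => ?_
  rw [gammaBar, liftChar_mk, Finsupp.linearCombination_apply, Finsupp.sum]
  exact Submodule.sum_mem _ fun c _ => Submodule.smul_mem _ _ (cosetCompl_mem_serreLattice R h c)

omit [NoZeroDivisors R] h2 in
/-- **`τD ↦ f_{τπ₀} = push(τψ₀)`**: the function `Γ/D → ℤ[Γ/D]` behind `X^*(β)` («the map `τ ↦ τπ₀` defines a bijection `Γ/D → Π`»; well defined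
since `D ⊂ Γ₀` fixes `push(ψ₀)`). [cite: Milne1999, §6 p. 70 L5–L6, L12–L15] -/
def germ : Γ ⧸ D → (Γ ⧸ D →₀ R) := fun c =>
  Quotient.liftOn' c (fun g : Γ => pushFun R ((↑) : Γ → Γ ⧸ D) (act R g (psi ι Γ₀ R 1))) fun a b hab => by
    have hab' : a⁻¹ * b ∈ D := QuotientGroup.leftRel_apply.mp hab
    have hδ : a⁻¹ * b ∈ Γ₀ := h.le hab'
    change pushFun R ((↑) : Γ → Γ ⧸ D) (act R a (psi ι Γ₀ R 1)) = pushFun R ((↑) : Γ → Γ ⧸ D) (act R b (psi ι Γ₀ R 1))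
    rw [show b = a * (a⁻¹ * b) by rw [mul_inv_cancel_left], act_mul, LinearMap.comp_apply, act_psi R h hδ, mul_one,
      pushFun_act R ((↑) : Γ → Γ ⧸ D) (g := a) (fun _ => rfl), pushFun_act R ((↑) : Γ → Γ ⧸ D) (g := a) (fun _ => rfl),
      pushFun_psi R h hδ, pushFun_psi R h Γ₀.one_mem, (QuotientGroup.eq (s := D)).mpr (by rwa [inv_one, one_mul])]

omit [NoZeroDivisors R] h2 in
/-- `germ(γD) = push(γψ₀)`. [cite: Milne1999, §6 p. 70 L12–L15] -/
theorem germ_coe (g : Γ) : germ R h (g : Γ ⧸ D) = pushFun R ((↑) : Γ → Γ ⧸ D) (act R g (psi ι Γ₀ R 1)) := rfl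

omit [NoZeroDivisors R] h2 in
/-- `germ c + germ (ιc) = push(s^K)`. [cite: Milne1999, §6 p. 70 L12–L15] -/
theorem germ_add_germ_smul (c : Γ ⧸ D) : germ R h c + germ R h (ι • c) = pushFun R ((↑) : Γ → Γ ⧸ D) (onesFun R) := by
  induction c using QuotientGroup.induction_on with | H g => ?_
  rw [MulAction.Quotient.smul_coe, smul_eq_mul, germ_coe, germ_coe, ← map_add, h.comm g, act_mul, LinearMap.comp_apply, ← map_add,
    psi_add_act_iota_psi R h Γ₀.one_mem, act_onesFun]

/-- **`X^*(β) : X^*(L^Π) → X^*(P^K) ↪ ℤ[Γ/D]`, `[τD] ↦ f_{τπ₀}`** (`X^*(L^Π) = ℤ[Π]/{f = ιf, Σ f = 0}`, `Π ≅ Γ/D`). [cite: Milne1999, §6 p. 70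
L5–L10 (Lemma 6.7)] -/
def betaPi : CharModule R (Γ ⧸ D) ι →ₗ[R] (Γ ⧸ D →₀ R) :=
  liftChar R ι (IsRegular.of_ne_zero h2) (germ R h) (pushFun R ((↑) : Γ → Γ ⧸ D) (onesFun R)) (germ_add_germ_smul R h)

/-- `X^*(β)[δ_{γD}] = push(γψ₀)`. [cite: Milne1999, §6 p. 70 L5–L10] -/
theorem betaPi_mk_single (g : Γ) :
    betaPi R h h2 (Submodule.Quotient.mk (Finsupp.single (g : Γ ⧸ D) 1)) = pushFun R ((↑) : Γ → Γ ⧸ D) (act R g (psi ι Γ₀ R 1)) :=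
  liftChar_mk_single R ι _ _ _ _ (g : Γ ⧸ D)

/-- The composite `ℤ[Γ/D] ↠ X^*(L^Π) −X^*(β)→ ℤ[Γ/D]` has the printed basis values `σ ↦ push(ψ_τ)`, `ισ ↦ push(ιψ_τ)` (g17-#2
`HasPrintedValues`). [cite: Milne1999, §6 p. 70 L12–L16] -/
theorem hasPrintedValues_betaPi :
    HasPrintedValues (ι := ι) (Γ₀ := Γ₀) (LinearMap.id ∘ₗ betaPi R h h2 ∘ₗ (rel R (Γ ⧸ D) ι).mkQ) where
  coe τ hτ := by
    rw [LinearMap.comp_apply, LinearMap.comp_apply, Submodule.mkQ_apply, betaPi_mk_single, LinearMap.id_apply, act_psi R h hτ, mul_one]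
  smul_coe τ hτ := by
    rw [LinearMap.comp_apply, LinearMap.comp_apply, Submodule.mkQ_apply, show ι • (τ : Γ ⧸ D) = ((ι * τ : Γ) : Γ ⧸ D) from rfl,
      betaPi_mk_single, LinearMap.id_apply, act_iota_mul_psi R h hτ, mul_one]

/-- **LEMMA 6.7's conclusion: `X^*(β) : X^*(L^Π) → X^*(P^K)` is injective** (for `d(2 − (n/d)d) ≠ 0`, i.e. `|Γ₀| ≠ 2` over `ℤ`; g17-#2).
[cite: Milne1999, §6 p. 70 Lemma 6.7] -/
theorem betaPi_injective (hd : (Fintype.card D : R) ≠ 0) (hn : (2 : R) - ((univ.filter (· ∈ Γ₀) : Finset Γ).card : R) ≠ 0) :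
    Function.Injective (betaPi R h h2) :=
  injective_of_hasPrintedValues h (betaPi R h h2) LinearMap.id (hasPrintedValues_betaPi R h h2) h2 (card_hyp h hd hn)

/-- **`X^*(β̄) : X^*(L^Π̄) → ℤ[Γ/D]`, `[π̄] ↦ f_π̄ = push(ψ̄)`, `[ιπ̄] ↦ push(ιψ̄)`** (`Π̄ = {π̄, ιπ̄} ≅ Γ/Γ₀`). [cite: Milne1999, §6 p. 70 L25–L30
(Lemma 6.8, bottom arrow)] -/
def betaBar : CharModule R (Γ ⧸ Γ₀) ι →ₗ[R] (Γ ⧸ D →₀ R) :=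
  liftChar R ι (IsRegular.of_ne_zero h2) (fun c => pushFun R ((↑) : Γ → Γ ⧸ D) (cosetCompl R c))
    (pushFun R ((↑) : Γ → Γ ⧸ D) (onesFun R)) fun c => by rw [← map_add, cosetCompl_add_cosetCompl_smul R h]

omit [DecidablePred (· ∈ D)] in
/-- `X^*(β̄)[δ_c] = push(cosetCompl c)`. [cite: Milne1999, §6 p. 70 L25–L30] -/
theorem betaBar_mk_single (c : Γ ⧸ Γ₀) :
    betaBar R h h2 (Submodule.Quotient.mk (Finsupp.single c 1)) = pushFun R ((↑) : Γ → Γ ⧸ D) (cosetCompl R c) :=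
  liftChar_mk_single R ι _ _ _ _ c

omit [NoZeroDivisors R] [Fintype Γ] [DecidableEq Γ] [DecidablePred (· ∈ Γ₀)] [DecidablePred (· ∈ D)] h2 in
/-- Every `f ∈ ℤ[Γ/Γ₀]` is `f(Γ₀)·[Γ₀] + f(ιΓ₀)·[ιΓ₀]`. [cite: Milne1999, §6 p. 70 L23–L24] -/
theorem eq_single_add_single (f : Γ ⧸ Γ₀ →₀ R) :
    f = f ((1 : Γ) : Γ ⧸ Γ₀) • Finsupp.single ((1 : Γ) : Γ ⧸ Γ₀) 1 +
      f (ι • ((1 : Γ) : Γ ⧸ Γ₀)) • Finsupp.single (ι • ((1 : Γ) : Γ ⧸ Γ₀)) 1 := by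
  have hΓ₀ : Setting ι Γ₀ Γ₀ := ⟨h.comm, h.mul_self, h.not_mem, h.mem_or_mem, le_rfl⟩
  have hne : ι • ((1 : Γ) : Γ ⧸ Γ₀) ≠ ((1 : Γ) : Γ ⧸ Γ₀) := hΓ₀.smul_ne_self _
  ext c
  induction c using QuotientGroup.induction_on with | H x => ?_
  simp only [Finsupp.add_apply, Finsupp.smul_apply, smul_eq_mul]
  rcases coe_eq_or h x ((1 : Γ) : Γ ⧸ Γ₀) with e | e
  · rw [e, Finsupp.single_eq_same, Finsupp.single_eq_of_ne hne.symm, mul_one, mul_zero, add_zero]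
  · rw [e, Finsupp.single_eq_of_ne hne, Finsupp.single_eq_same, mul_zero, mul_one, zero_add]

/-- **LEMMA 6.8: `X^*(β̄) : X^*(L^Π̄) → X^*(P^K)` is injective** («as in the preceding lemma, one shows that the bottom arrow is injective»:
`f_π̄ = dΣ ισ_i` and `f_{ιπ̄} = dΣ σ_i` are linearly independent, `d ≠ 0`). [cite: Milne1999, §6 p. 70 Lemma 6.8] -/
theorem betaBar_injective (hd : (Fintype.card D : R) ≠ 0) : Function.Injective (betaBar R h h2) := by
  rw [← LinearMap.ker_eq_bot, Submodule.eq_bot_iff]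
  intro x hx
  induction x using Submodule.Quotient.induction_on with | H f => ?_
  have k₀mem : ((1 : Γ) : Γ ⧸ D) ∈ halfCosets Γ₀ D := coe_mem_halfCosets Γ₀.one_mem
  -- the two sums `Σ_i ισ_i`, `Σ_i σ_i` evaluated through the numbering `frame`
  have e1 : ∀ s, (∑ k : ↥(halfCosets Γ₀ D), Finsupp.single (ι • (k : Γ ⧸ D)) (1 : R)) (frame h s) =
      Sum.elim (fun _ => (0 : R)) (fun _ => 1) s := by
    intro s
    rw [Finsupp.finsetSum_apply]
    simp_rw [← frame_inr h, Finsupp.single_apply, (frame h).injective.eq_iff]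
    rcases s with k | k <;> simp
  have e2 : ∀ s, (∑ k : ↥(halfCosets Γ₀ D), Finsupp.single (k : Γ ⧸ D) (1 : R)) (frame h s) =
      Sum.elim (fun _ => (1 : R)) (fun _ => 0) s := by
    intro s
    rw [Finsupp.finsetSum_apply]
    simp_rw [← frame_inl h, Finsupp.single_apply, (frame h).injective.eq_iff]
    rcases s with k | k <;> simp
  rw [LinearMap.mem_ker, eq_single_add_single R h f, Submodule.Quotient.mk_add, Submodule.Quotient.mk_smul, Submodule.Quotient.mk_smul,
    map_add, map_smul, map_smul, betaBar_mk_single, betaBar_mk_single, cosetCompl_one_eq_psiBar R h, ← act_iota_cosetCompl R h,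
    cosetCompl_one_eq_psiBar R h, pushFun_act R ((↑) : Γ → Γ ⧸ D) (g := ι) (fun _ => rfl), pushFun_psiBar R h,
    LinearMap.map_smul (act R ι), map_sum (act R ι)] at hx
  simp_rw [act_single, h.smul_smul_eq] at hx
  have hb : f (ι • ((1 : Γ) : Γ ⧸ Γ₀)) = 0 := by
    have := DFunLike.congr_fun hx (frame h (Sum.inl ⟨_, k₀mem⟩))
    rw [Finsupp.add_apply, Finsupp.smul_apply, Finsupp.smul_apply, Finsupp.smul_apply, Finsupp.smul_apply, e1, e2, Sum.elim_inl,
      Sum.elim_inl, Finsupp.zero_apply, smul_zero, smul_zero, zero_add, smul_eq_mul, smul_eq_mul, mul_one] at this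
    exact (mul_eq_zero.mp this).resolve_right hd
  have ha : f ((1 : Γ) : Γ ⧸ Γ₀) = 0 := by
    have := DFunLike.congr_fun hx (frame h (Sum.inr ⟨_, k₀mem⟩))
    rw [Finsupp.add_apply, Finsupp.smul_apply, Finsupp.smul_apply, Finsupp.smul_apply, Finsupp.smul_apply, e1, e2, Sum.elim_inr,
      Sum.elim_inr, Finsupp.zero_apply, smul_zero, smul_zero, add_zero, smul_eq_mul, smul_eq_mul, mul_one] at this
    exact (mul_eq_zero.mp this).resolve_right hd
  have hf : f = 0 := by
    rw [eq_single_add_single R h f, ha, hb, zero_smul, zero_smul, add_zero]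
  rw [hf, Submodule.Quotient.mk_zero]

end Maps

/-! ### §4 LEMMA 6.9: the square `X^*(T^Ψ) ⊕ X^*(T^Ψ̄) → X^*(S^K)` over `X^*(L^Π) ⊕ X^*(L^Π̄) → X^*(P^K)` is almost cartesian -/

section Square

variable [NoZeroDivisors R] (h : Setting ι Γ₀ D) (h2 : (2 : R) ≠ 0)

include h h2

/-- **Top arrow `X^*(T^Ψ) ⊕ X^*(T^Ψ̄) → X^*(S^K)`**, `(x, y) ↦ X^*(γ)x + X^*(γ̄)y`. [cite: Milne1999, §6 p. 71 L1–L3 (Lemma 6.9)] -/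
def topMap : CharModule R Γ ι × CharModule R (Γ ⧸ Γ₀) ι →ₗ[R] serreLattice ι R :=
  LinearMap.codRestrict (serreLattice ι R) ((gammaPsi R h h2).coprod (gammaBar R h h2)) fun x => by
    rw [LinearMap.coprod_apply]
    exact Submodule.add_mem _ (gammaPsi_mem R h h2 x.1) (gammaBar_mem R h h2 x.2)

omit [DecidablePred (· ∈ D)] in
/-- [cite: Milne1999, §6 p. 71 L1–L3] -/
@[simp] theorem coe_topMap (x : CharModule R Γ ι × CharModule R (Γ ⧸ Γ₀) ι) :
    (topMap R h h2 x : Γ →₀ R) = gammaPsi R h h2 x.1 + gammaBar R h h2 x.2 := rfl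

omit [NoZeroDivisors R] h h2 in
variable (ι Γ₀ D) in
/-- **Left arrow `X^*(T^Ψ) ⊕ X^*(T^Ψ̄) → X^*(L^Π) ⊕ X^*(L^Π̄)`**: `X^*(α′)` on the first summand is the push along `Ψ ≅ Γ → Γ/D ≅ Π`
(`γψ₀ ↦ γπ₀`), and `ψ̄ ↦ π̄` is the identity of `ℤ[Γ/Γ₀]/rel`. [cite: Milne1999, §6 p. 71 L1–L3 (Lemma 6.9); §5 p. 65 («reduction»)] -/
def leftMap : CharModule R Γ ι × CharModule R (Γ ⧸ Γ₀) ι →ₗ[R] CharModule R (Γ ⧸ D) ι × CharModule R (Γ ⧸ Γ₀) ι :=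
  (push R ι ((↑) : Γ → Γ ⧸ D) fun _ => rfl).prodMap LinearMap.id

omit [Fintype Γ] [DecidableEq Γ] [DecidablePred (· ∈ Γ₀)] [DecidablePred (· ∈ D)] [NoZeroDivisors R] h h2 in
/-- [cite: Milne1999, §6 p. 71 L1–L3] -/
@[simp] theorem leftMap_apply (x : CharModule R Γ ι × CharModule R (Γ ⧸ Γ₀) ι) :
    leftMap ι Γ₀ D R x = (push R ι ((↑) : Γ → Γ ⧸ D) (fun _ => rfl) x.1, x.2) := rfl

/-- The values of the bottom arrow lie in `X^*(P^K)`. [cite: Milne1999, §6 p. 71 L1–L3] -/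
theorem coprod_beta_mem (y : CharModule R (Γ ⧸ D) ι × CharModule R (Γ ⧸ Γ₀) ι) :
    ((betaPi R h h2).coprod (betaBar R h h2)) y ∈ weilLattice ι D R := by
  obtain ⟨y₁, y₂⟩ := y
  rw [LinearMap.coprod_apply]
  refine Submodule.add_mem _ ?_ ?_
  · induction y₁ using Submodule.Quotient.induction_on with | H f => ?_
    rw [betaPi, liftChar_mk, Finsupp.linearCombination_apply, Finsupp.sum]
    refine Submodule.sum_mem _ fun c _ => Submodule.smul_mem _ _ ?_
    induction c using QuotientGroup.induction_on with | H g => ?_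
    rw [germ_coe]
    exact LinearMap.mem_range.mpr ⟨⟨_, act_mem_serreLattice R h g (psi_mem_serreLattice R h Γ₀.one_mem)⟩, rfl⟩
  · induction y₂ using Submodule.Quotient.induction_on with | H f => ?_
    rw [betaBar, liftChar_mk, Finsupp.linearCombination_apply, Finsupp.sum]
    refine Submodule.sum_mem _ fun c _ => Submodule.smul_mem _ _ ?_
    exact LinearMap.mem_range.mpr ⟨⟨_, cosetCompl_mem_serreLattice R h c⟩, rfl⟩

/-- **Bottom arrow `X^*(L^Π) ⊕ X^*(L^Π̄) → X^*(P^K)`**, `(x, y) ↦ X^*(β)x + X^*(β̄)y`. [cite: Milne1999, §6 p. 71 L1–L3 (Lemma 6.9)] -/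
def bottomMap : CharModule R (Γ ⧸ D) ι × CharModule R (Γ ⧸ Γ₀) ι →ₗ[R] weilLattice ι D R :=
  LinearMap.codRestrict (weilLattice ι D R) ((betaPi R h h2).coprod (betaBar R h h2)) (coprod_beta_mem R h h2)

/-- [cite: Milne1999, §6 p. 71 L1–L3] -/
@[simp] theorem coe_bottomMap (y : CharModule R (Γ ⧸ D) ι × CharModule R (Γ ⧸ Γ₀) ι) :
    (bottomMap R h h2 y : Γ ⧸ D →₀ R) = betaPi R h h2 y.1 + betaBar R h h2 y.2 := rfl

/-- Lemma 6.2 for `Ψ` on characters: `X^*(β)(X^*(α′)[f]) = push(X^*(γ)[f])` (both send `[δ_γ]` to `push(γψ₀) = f_{γπ₀}`). [cite: Milne1999, §6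
p. 66 Lemma 6.2; p. 70 L12–L15] -/
theorem betaPi_push_mk (f : Γ →₀ R) :
    betaPi R h h2 (push R ι ((↑) : Γ → Γ ⧸ D) (fun _ => rfl) (Submodule.Quotient.mk f)) =
      pushFun R ((↑) : Γ → Γ ⧸ D) (gammaPsi R h h2 (Submodule.Quotient.mk f)) := by
  induction f using Finsupp.induction_linear with
  | zero => rw [Submodule.Quotient.mk_zero, map_zero, map_zero, map_zero, map_zero]
  | add f₁ f₂ h₁ h₂ => rw [Submodule.Quotient.mk_add, map_add, map_add, map_add, map_add, h₁, h₂]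
  | single g r =>
    rw [← Finsupp.smul_single_one, Submodule.Quotient.mk_smul, map_smul, map_smul, map_smul, map_smul, push_mk, pushFun_single,
      betaPi_mk_single, gammaPsi_mk_single]

omit [DecidablePred (· ∈ D)] in
/-- Lemma 6.2 for `Ψ̄` on characters: `X^*(β̄)[f] = push(X^*(γ̄)[f])`. [cite: Milne1999, §6 p. 66 Lemma 6.2; p. 70 L23–L30] -/
theorem betaBar_mk (f : Γ ⧸ Γ₀ →₀ R) :
    betaBar R h h2 (Submodule.Quotient.mk f) = pushFun R ((↑) : Γ → Γ ⧸ D) (gammaBar R h h2 (Submodule.Quotient.mk f)) := by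
  induction f using Finsupp.induction_linear with
  | zero => rw [Submodule.Quotient.mk_zero, map_zero, map_zero, map_zero]
  | add f₁ f₂ h₁ h₂ => rw [Submodule.Quotient.mk_add, map_add, map_add, map_add, h₁, h₂]
  | single c r =>
    rw [← Finsupp.smul_single_one, Submodule.Quotient.mk_smul, map_smul, map_smul, map_smul, betaBar_mk_single, gammaBar_mk_single]

/-- **The square commutes**: `X^*(α) ∘ (X^*(γ) + X^*(γ̄)) = (X^*(β) + X^*(β̄)) ∘ (X^*(α′) ⊕ 1)` (Lemma 6.2 for the orbits `Ψ`, `Ψ̄`).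
[cite: Milne1999, §6 p. 66 Lemma 6.2; p. 71 L1–L3] -/
theorem square_comm (x : CharModule R Γ ι × CharModule R (Γ ⧸ Γ₀) ι) :
    bottomMap R h h2 (leftMap ι Γ₀ D R x) = alphaP ι D R (topMap R h h2 x) := by
  apply Subtype.ext
  rw [coe_bottomMap, coe_alphaP, coe_topMap, leftMap_apply, map_add]
  obtain ⟨x₁, x₂⟩ := x
  dsimp only
  induction x₁ using Submodule.Quotient.induction_on with | H f => ?_
  induction x₂ using Submodule.Quotient.induction_on with | H g => ?_
  rw [betaPi_push_mk, betaBar_mk]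

omit [DecidablePred (· ∈ D)] in
/-- `X^*(γ)[Σ_τ c_τ δ_τ] = Σ_τ c_τ ψ_τ` for `τ` ranging in `Γ₀`. [cite: Milne1999, §6 p. 70 L1, p. 71 L13–L15] -/
theorem gammaPsi_mk_sum (c : Γ → R) :
    gammaPsi R h h2 (Submodule.Quotient.mk (∑ τ ∈ univ.filter (· ∈ Γ₀), c τ • Finsupp.single τ 1)) =
      ∑ τ ∈ univ.filter (· ∈ Γ₀), c τ • psi ι Γ₀ R τ := by
  rw [gammaPsi, liftChar_mk, map_sum]
  refine Finset.sum_congr rfl fun τ hτ => ?_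
  rw [map_smul, Finsupp.linearCombination_single, one_smul, act_psi R h (mem_filter.mp hτ).2, mul_one]

omit [DecidableEq Γ] [NoZeroDivisors R] h h2 in
/-- `push(Σ_{τ∈Γ₀} c_τ τ) = Σ_i (Σ_{τ_j ∈ σ_i} c_j) σ_i` (the block sums). [cite: Milne1999, §6 p. 71 L13–L15] -/
theorem pushFun_sum_smul_single (c : Γ → R) :
    pushFun R ((↑) : Γ → Γ ⧸ D) (∑ τ ∈ univ.filter (· ∈ Γ₀), c τ • Finsupp.single τ 1) =
      ∑ k ∈ halfCosets Γ₀ D, (∑ τ ∈ (univ.filter (· ∈ Γ₀)).filter (fun g : Γ => (g : Γ ⧸ D) = k), c τ) • Finsupp.single k 1 := by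
  rw [map_sum]
  simp_rw [map_smul, pushFun_single]
  refine (Finset.sum_image' _ fun τ₁ hτ₁ => ?_).symm
  rw [Finset.sum_smul]
  exact Finset.sum_congr rfl fun τ hτ => by rw [(mem_filter.mp hτ).2]

omit [DecidablePred (· ∈ D)] in
/-- **«The image of the top-right map contains `ψ₀, …, ψ_{n−1}, ψ̄` and, hence, is onto»**: the top arrow is onto `X^*(S^K)` (Lemma 3.3).
[cite: Milne1999, §6 p. 71 L9–L10 (proof of Lemma 6.9)] -/
theorem topMap_surjective : Function.Surjective (topMap R h h2) := by
  intro s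
  refine ⟨(Submodule.Quotient.mk (∑ τ ∈ univ.filter (· ∈ Γ₀), (s : Γ →₀ R) τ • Finsupp.single τ 1),
    Submodule.Quotient.mk (((s : Γ →₀ R) 1 + (s : Γ →₀ R) ι - ∑ τ ∈ univ.filter (· ∈ Γ₀), (s : Γ →₀ R) τ) •
      Finsupp.single ((1 : Γ) : Γ ⧸ Γ₀) 1)), Subtype.ext ?_⟩
  rw [coe_topMap, gammaPsi_mk_sum, Submodule.Quotient.mk_smul, map_smul, gammaBar_mk_single, cosetCompl_one_eq_psiBar R h]
  exact (eq_sum_psi_add_psiBar R h s.2).symm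

omit [Fintype Γ] [DecidableEq Γ] [DecidablePred (· ∈ Γ₀)] [DecidablePred (· ∈ D)] [NoZeroDivisors R] h h2 in
/-- The left arrow is onto («induces a surjective homomorphism `X^*(T^Ψ) → X^*(L^Π)`», §5). [cite: Milne1999, §5 p. 65; §6 p. 71 L10–L11] -/
theorem leftMap_surjective : Function.Surjective (leftMap ι Γ₀ D R) := by
  intro y
  obtain ⟨y₁, y₂⟩ := y
  obtain ⟨x₁, rfl⟩ := push_surjective R ι ((↑) : Γ → Γ ⧸ D) (fun _ => rfl) (QuotientGroup.mk_surjective) y₁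
  exact ⟨(x₁, y₂), rfl⟩

/-- **«Since the vertical maps are both onto, this shows that all the maps in the square are onto»**: the bottom arrow is onto `X^*(P^K)`.
[cite: Milne1999, §6 p. 71 L10–L11 (proof of Lemma 6.9)] -/
theorem bottomMap_surjective : Function.Surjective (bottomMap R h h2) := by
  intro y
  obtain ⟨s, rfl⟩ := alphaP_surjective (ι := ι) (D := D) R y
  obtain ⟨x, rfl⟩ := topMap_surjective R h h2 s
  exact ⟨leftMap ι Γ₀ D R x, square_comm R h h2 x⟩

/-- **LEMMA 6.9: the square `X^*(T^Ψ) ⊕ X^*(T^Ψ̄) → X^*(S^K)` / `X^*(L^Π) ⊕ X^*(L^Π̄) → X^*(P^K)` is almost cartesian** (by LEMMA 6.3 (c):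
an `f ∈ X^*(S^K)` killed by `X^*(α)` has `a = 0` and vanishing block sums, so it is `X^*(γ)` of `[Σ a_iδ_{τ_i}]`, which `X^*(α′)` kills), for
`2 ≠ 0` and `d ≠ 0` in `R`. [cite: Milne1999, §6 p. 71 Lemma 6.9] -/
theorem isAlmostCartesian_square (hd : (Fintype.card D : R) ≠ 0) :
    IsAlmostCartesian (R := R) (N' := CharModule R Γ ι × CharModule R (Γ ⧸ Γ₀) ι) (N := ↥(serreLattice ι R))
      (M' := CharModule R (Γ ⧸ D) ι × CharModule R (Γ ⧸ Γ₀) ι) (M := ↥(weilLattice ι D R))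
      (leftMap ι Γ₀ D R) (topMap R h h2) (bottomMap R h h2) (alphaP ι D R) := by
  have hc' : ∀ x, alphaP ι D R (topMap R h h2 x) = bottomMap R h h2 (leftMap ι Γ₀ D R x) := fun x => (square_comm R h h2 x).symm
  refine (IsAlmostCartesian.of_kerMap_surjective (R := R) (N' := CharModule R Γ ι × CharModule R (Γ ⧸ Γ₀) ι)
    (N := CharModule R (Γ ⧸ D) ι × CharModule R (Γ ⧸ Γ₀) ι) (M' := ↥(serreLattice ι R)) (M := ↥(weilLattice ι D R))
    hc' (topMap_surjective R h h2) (leftMap_surjective (ι := ι) (Γ₀ := Γ₀) (D := D) R)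
    (alphaP_surjective (ι := ι) (D := D) R) (bottomMap_surjective R h h2) ?_).symm
  -- (c): `Ker(leftMap) → Ker(alphaP)`, `x ↦ topMap x`, is onto
  rintro ⟨s, hs⟩
  have hs0 : pushFun R ((↑) : Γ → Γ ⧸ D) (s : Γ →₀ R) = 0 := by
    have := congrArg (fun y : weilLattice ι D R => (y : Γ ⧸ D →₀ R)) (LinearMap.mem_ker.mp hs)
    simpa using this
  obtain ⟨hA, hc⟩ := (alphaS_eq_zero_iff R h hd s.2).mp hs0
  have hsum : ∑ τ ∈ univ.filter (· ∈ Γ₀), (s : Γ →₀ R) τ = 0 := by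
    rw [← Finset.sum_fiberwise_of_maps_to (s := univ.filter (· ∈ Γ₀)) (t := halfCosets Γ₀ D) (g := ((↑) : Γ → Γ ⧸ D))
      fun τ hτ => mem_image_of_mem _ hτ]
    exact Finset.sum_eq_zero fun k hk => by
      obtain ⟨τ, hτ, rfl⟩ := exists_rep_of_mem_halfCosets hk
      rw [filter_filter_coe_eq h.le hτ]
      exact hA τ hτ
  let x : CharModule R Γ ι × CharModule R (Γ ⧸ Γ₀) ι :=
    (Submodule.Quotient.mk (∑ τ ∈ univ.filter (· ∈ Γ₀), (s : Γ →₀ R) τ • Finsupp.single τ 1), 0)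
  have hx : leftMap ι Γ₀ D R x = 0 := by
    rw [leftMap_apply, Prod.mk_eq_zero]
    refine ⟨?_, rfl⟩
    change push R ι ((↑) : Γ → Γ ⧸ D) (fun _ => rfl) (Submodule.Quotient.mk _) = 0
    rw [push_mk, pushFun_sum_smul_single, Finset.sum_eq_zero fun k hk => ?_, Submodule.Quotient.mk_zero]
    obtain ⟨τ, hτ, rfl⟩ := exists_rep_of_mem_halfCosets hk
    rw [filter_filter_coe_eq h.le hτ, hA τ hτ, zero_smul]
  refine ⟨⟨x, LinearMap.mem_ker.mpr hx⟩, Subtype.ext (Subtype.ext ?_)⟩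
  rw [coe_kerMap]
  change ((topMap R h h2 x : serreLattice ι R) : Γ →₀ R) = (s : Γ →₀ R)
  rw [coe_topMap, gammaPsi_mk_sum, map_zero, add_zero]
  conv_rhs => rw [eq_sum_psi_add_psiBar R h s.2, hc, hsum, sub_zero, zero_smul, add_zero]

omit h2 in
/-- **LEMMA 6.9 over `ℤ`** (the printed lattices; `d = |D| ⩾ 1` automatically). [cite: Milne1999, §6 p. 71 Lemma 6.9] -/
theorem int_isAlmostCartesian_square :
    IsAlmostCartesian (R := ℤ) (N' := CharModule ℤ Γ ι × CharModule ℤ (Γ ⧸ Γ₀) ι) (N := ↥(serreLattice ι ℤ))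
      (M' := CharModule ℤ (Γ ⧸ D) ι × CharModule ℤ (Γ ⧸ Γ₀) ι) (M := ↥(weilLattice ι D ℤ))
      (leftMap ι Γ₀ D ℤ) (topMap ℤ h two_ne_zero) (bottomMap ℤ h two_ne_zero) (alphaP ι D ℤ) :=
  isAlmostCartesian_square ℤ h two_ne_zero (by exact_mod_cast Fintype.card_ne_zero)

end Square

end CosetGerm

end Literature.NumberTheory.ComplexMultiplication
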